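import Mathlib
import Summits.QuantumAdvantage.QuantumAdvantage.Theorems.LinnikCubicClassGroupsPureCubicClassNumberHardStubFieldSetup
import Summits.QuantumAdvantage.QuantumAdvantage.Theorems.LinnikCubicClassGroupsPureCubicClassNumberHardStubClassNumberNotDvd
import Literature.NumberTheory.NumberFields.PureCubicClassNumberModThreeProofs
import HarnessLib

/-!
# The Galois group of `K(ζ₃)/ℚ` for a cubic field `K ∋ ∛m`: `τστ = σ²`

Route `LinnikCubicClassGroups` (rank-0 hypothesis-type target `PureCubicClassNumberHard`,
stmt-QuantumAdvantage-11826): infrastructure for the Hasse-free DESCENT `3 ∣ h(K(ζ₃)) ⟹ 3 ∣ h(K)`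
of Honda's criterion (`…PureCubicClassNumberHardDescent.lean`).

For a cubic number field `K` (no primitive cube root of unity, cube roots unique), the quadratic
Galois extension `L = K(ζ₃)` with `Gal(L/K) = {1, τ}`, and the quadratic subfield `F = ℚ(ζ₃)` with
`Gal(L/F) = ⟨σ⟩` cyclic of order `3`:

* `algEquiv_eq_one_or_eq_of_finrank_eq_two`, `exists_algEquiv_ne_one_of_finrank_eq_two`,
  `mul_self_eq_one_of_finrank_eq_two`, `exists_algebraMap_eq_of_fixed` — `Gal(L/K) = {1, τ}`,
  `τ² = 1`, `τ`-fixed elements lie in `K`;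
* `sq_add_self_add_one_ne_zero`, `eq_of_pow_three_eq` — a cubic field has no root of `X² + X + 1`,
  so cube roots in it are unique;
* `algEquiv_eq_of_forall_mem_zpowers` — `Gal(L/F) = {1, σ, σ²}`;
* `apply_apply_eq_of_generators` — **`τσ = σ²τ`** (the group `Gal(L/ℚ) ≅ S₃` is not abelian):
  `ρ = τστ` fixes the normal subfield `F`, so `ρ ∈ {1, σ, σ²}`; `ρ = 1` forces `σ = 1`, `ρ = σ`
  makes `σ(∛m)` a `τ`-fixed cube root of `m`, i.e. `σ(∛m) = ∛m`; and `apply_apply_apply_eq`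
  (`τσ² = στ`).

HONEST FRAMING (block-2b rule): kernel-checked classical Galois theory, NOT summit progress; the
crux `PureCubicClassNumberHard` is hypothesis-type and untouched.

## References
* T. Honda, *Pure cubic fields whose class numbers are multiples of three*, J. Number Theory 3
  (1971) 7–12. [Honda1971]
-/

set_option linter.dupNamespace false

open NumberField Polynomial

open scoped Pointwise NumberField nonZeroDivisors

namespace Summit.QuantumAdvantage.QuantumAdvantage.Theorems.LinnikCubicClassGroups

open Literature.NumberTheory.NumberFields

variable {K L : Type*} [Field K] [NumberField K] [Field L] [NumberField L] [Algebra K L]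

/-! ### Quadratic Galois extensions -/

/-- In a Galois extension of degree `2` with a nontrivial automorphism `τ`, every automorphism is
`1` or `τ`. [folklore] -/
theorem algEquiv_eq_one_or_eq_of_finrank_eq_two [IsGalois K L] (h2 : Module.finrank K L = 2)
    {τ : L ≃ₐ[K] L} (hτ : τ ≠ 1) (g : L ≃ₐ[K] L) : g = 1 ∨ g = τ := by
  classical
  by_contra! h
  have hcard : Fintype.card (L ≃ₐ[K] L) = 2 := by
    rw [← Nat.card_eq_fintype_card, IsGalois.card_aut_eq_finrank, h2]
  have hle : ({1, τ, g} : Finset (L ≃ₐ[K] L)).card ≤ 2 := hcard ▸ Finset.card_le_univ _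
  rw [Finset.card_insert_of_notMem, Finset.card_pair (fun h' => h.2 h'.symm)] at hle
  · omega
  · simp only [Finset.mem_insert, Finset.mem_singleton, not_or]
    exact ⟨fun h' => hτ h'.symm, fun h' => h.1 h'.symm⟩

/-- A quadratic Galois extension has a nontrivial automorphism. [folklore] -/
theorem exists_algEquiv_ne_one_of_finrank_eq_two [IsGalois K L] (hKL : Module.finrank K L = 2) :
    ∃ τ : L ≃ₐ[K] L, τ ≠ 1 := by
  classical
  have hcard : 1 < Fintype.card (L ≃ₐ[K] L) := by
    rw [← Nat.card_eq_fintype_card, IsGalois.card_aut_eq_finrank, hKL]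
    norm_num
  exact Fintype.exists_ne_of_one_lt_card hcard 1

/-- The nontrivial automorphism of a quadratic Galois extension is an involution. [folklore] -/
theorem mul_self_eq_one_of_finrank_eq_two [IsGalois K L] (hKL : Module.finrank K L = 2)
    {τ : L ≃ₐ[K] L} (hτ : τ ≠ 1) : τ * τ = 1 := by
  rcases algEquiv_eq_one_or_eq_of_finrank_eq_two hKL hτ (τ * τ) with h | h
  · exact h
  · exact absurd (mul_eq_left.mp h) hτ

/-- In a quadratic Galois extension `L/K` with `Gal = {1, τ}`, a `τ`-fixed element lies in `K`.
[folklore] -/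
theorem exists_algebraMap_eq_of_fixed [IsGalois K L] (hKL : Module.finrank K L = 2)
    {τ : L ≃ₐ[K] L} (hτ : τ ≠ 1) {z : L} (hz : τ z = z) : ∃ k : K, algebraMap K L k = z := by
  refine (IsGalois.mem_range_algebraMap_iff_fixed (F := K) z).mpr fun g => ?_
  rcases algEquiv_eq_one_or_eq_of_finrank_eq_two hKL hτ g with rfl | rfl
  · rfl
  · exact hz

/-! ### Cubic fields contain no primitive cube root of unity -/

/-- A cubic number field contains no root of `X² + X + 1`. [folklore] -/
theorem sq_add_self_add_one_ne_zero (hK : Module.finrank ℚ K = 3) (k : K) :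
    k ^ 2 + k + 1 ≠ 0 := by
  intro h
  have hirr := irreducible_cyclotomic_three_of_finrank_eq_three hK
  have hroot : (cyclotomic 3 K).IsRoot k := by
    rw [cyclotomic_three, IsRoot.def]
    simp only [eval_add, eval_pow, eval_X, eval_one]
    exact h
  have hdeg := degree_eq_one_of_irreducible_of_root hirr hroot
  have h2 : (cyclotomic 3 K).natDegree = 2 := by
    rw [natDegree_cyclotomic, Nat.totient_prime Nat.prime_three]
  have h1 : (cyclotomic 3 K).natDegree = 1 := natDegree_eq_of_degree_eq_some hdeg
  omega

/-- **Cube roots are unique in a cubic number field**: `k³ = θ³ ≠ 0` forces `k = θ`. [folklore] -/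
theorem eq_of_pow_three_eq (hK : Module.finrank ℚ K = 3) {k θ : K} (hθ : θ ≠ 0)
    (h : k ^ 3 = θ ^ 3) : k = θ := by
  have hfac : (k - θ) * (k ^ 2 + k * θ + θ ^ 2) = 0 := by linear_combination h
  rcases mul_eq_zero.mp hfac with h1 | h2
  · exact sub_eq_zero.mp h1
  · exfalso
    apply sq_add_self_add_one_ne_zero hK (k / θ)
    field_simp
    linear_combination h2

/-! ### Cyclic cubic extensions: the three automorphisms -/

/-- In a cyclic cubic extension with generator `σ`, every automorphism is `1`, `σ` or `σ²`.
[folklore] -/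
theorem algEquiv_eq_of_forall_mem_zpowers (F : IntermediateField ℚ L) [IsGalois F L]
    {σ : L ≃ₐ[F] L} (hσ : ∀ τ : L ≃ₐ[F] L, τ ∈ Subgroup.zpowers σ)
    (hFL : Module.finrank F L = 3) (g : L ≃ₐ[F] L) : g = 1 ∨ g = σ ∨ g = σ * σ := by
  have hσ3 := pow_three_eq_one_of_finrank_eq_three hσ hFL
  have hσ1 : σ ≠ 1 := by
    intro h1
    have hcard : Nat.card (L ≃ₐ[F] L) = 3 := by rw [IsGalois.card_aut_eq_finrank, hFL]
    rw [← orderOf_eq_card_of_forall_mem_zpowers hσ, h1, orderOf_one] at hcard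
    norm_num at hcard
  haveI : Fact (Nat.Prime 3) := ⟨Nat.prime_three⟩
  have hord : orderOf σ = 3 := orderOf_eq_prime hσ3 hσ1
  obtain ⟨k, rfl⟩ := Subgroup.mem_zpowers_iff.mp (hσ g)
  have hk : σ ^ k = σ ^ (k % 3) := by
    rw [← zpow_mod_orderOf, hord]
    rfl
  have h0 : 0 ≤ k % 3 := Int.emod_nonneg _ (by norm_num)
  have h3 : k % 3 < 3 := Int.emod_lt_of_pos _ (by norm_num)
  rw [hk]
  interval_cases (k % 3)
  · left
    exact zpow_zero σ
  · right
    left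
    exact zpow_one σ
  · right
    right
    rw [show (2 : ℤ) = ((2 : ℕ) : ℤ) from rfl, zpow_natCast, pow_two]

/-! ### `τσ = σ²τ` -/

/-- **The Galois group of `L = K(ζ₃)` over `ℚ` is not abelian: `τστ = σ²`.**  Here `K` is a
cubic field with an element `θ` (`θ³ = m ≠ 0`) moved by the generator `σ` of `Gal(L/F)`,
`F ⊆ L` the quadratic subfield `ℚ(ζ₃)` (normal over `ℚ`), and `τ` generates `Gal(L/K)`.
Proof: `ρ = τστ` fixes `F`, so `ρ ∈ {1, σ, σ²}`; `ρ = 1` forces `σ = 1`, and `ρ = σ` forces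
`σθ` to be `τ`-fixed, i.e. a cube root of `m` in `K`, i.e. `σθ = θ`. [folklore] -/
theorem apply_apply_eq_of_generators (hK : Module.finrank ℚ K = 3) [IsGalois ℚ L] [IsGalois K L]
    (hKL : Module.finrank K L = 2) {τ : L ≃ₐ[K] L} (hτ : τ ≠ 1)
    (F : IntermediateField ℚ L) [IsGalois F L] (hF2 : Module.finrank ℚ F = 2)
    {ζ : 𝓞 F} (hζ : ζ ^ 2 + ζ + 1 = 0)
    {σ : L ≃ₐ[F] L} (hσ : ∀ g : L ≃ₐ[F] L, g ∈ Subgroup.zpowers σ)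
    (hFL : Module.finrank F L = 3) {θ : K} {m : ℕ} (hm : m ≠ 0) (hθ3 : θ ^ 3 = (m : K))
    (hθσ : σ (algebraMap K L θ) ≠ algebraMap K L θ) (z : L) :
    τ (σ z) = σ (σ (τ z)) := by
  classical
  haveI := Honda1971.isCyclotomicExtension_three F hF2 hζ
  haveI : IsGalois ℚ F := IsCyclotomicExtension.isGalois {3} ℚ F
  have hFmap : ∀ (φ : L ≃ₐ[ℚ] L) (f : F), φ (f : L) ∈ F := by
    intro φ f
    have hn : Normal ℚ F := inferInstance
    exact (IntermediateField.normal_iff_forall_map_le'.mp hn φ) ⟨f, f.2, rfl⟩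
  have hττ : ∀ w : L, τ (τ w) = w := fun w => by
    rw [← AlgEquiv.mul_apply, mul_self_eq_one_of_finrank_eq_two hKL hτ, AlgEquiv.one_apply]
  let τℚ : L ≃ₐ[ℚ] L := τ.restrictScalars ℚ
  let σℚ : L ≃ₐ[ℚ] L := σ.restrictScalars ℚ
  let ρ₀ : L ≃ₐ[ℚ] L := τℚ.trans (σℚ.trans τℚ)
  have hρ₀ : ∀ w, ρ₀ w = τ (σ (τ w)) := fun w => rfl
  have hfixF : ∀ f : F, ρ₀.toRingEquiv (algebraMap F L f) = algebraMap F L f := by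
    intro f
    change ρ₀ (f : L) = f
    rw [hρ₀]
    have hmem : τ (f : L) ∈ F := hFmap τℚ f
    have : σ (τ (f : L)) = τ f := σ.commutes ⟨τ f, hmem⟩
    rw [this, hττ]
  let g : L ≃ₐ[F] L := AlgEquiv.ofRingEquiv hfixF
  have hg : ∀ w, g w = τ (σ (τ w)) := fun w => rfl
  rcases algEquiv_eq_of_forall_mem_zpowers F hσ hFL g with h1 | h2 | h3
  · -- `ρ = 1` would force `σ = 1`
    exfalso
    have hσ1 : σ = 1 := by
      ext w
      have := hg (τ w)
      rw [h1, hττ, AlgEquiv.one_apply] at this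
      exact τ.injective this.symm
    have hcard : Nat.card (L ≃ₐ[F] L) = 3 := by
      rw [IsGalois.card_aut_eq_finrank, hFL]
    rw [← orderOf_eq_card_of_forall_mem_zpowers hσ, hσ1, orderOf_one] at hcard
    norm_num at hcard
  · -- `ρ = σ`: then `σθ` is `τ`-fixed, a cube root of `m` in `K`
    exfalso
    set α : L := algebraMap K L θ with hαdef
    have hτα : τ α = α := τ.commutes θ
    have hα3 : α ^ 3 = (m : L) := by
      rw [hαdef, ← map_pow, hθ3, map_natCast]
    have h' : τ (σ α) = σ α := by
      have := hg α
      rw [h2, hτα] at this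
      exact this.symm
    obtain ⟨k, hk⟩ := exists_algebraMap_eq_of_fixed hKL hτ h'
    have hθ0 : θ ≠ 0 := by
      intro h0
      rw [h0, zero_pow three_ne_zero] at hθ3
      exact hm (by exact_mod_cast hθ3.symm)
    have hk3 : k ^ 3 = θ ^ 3 := by
      apply (algebraMap K L).injective
      rw [map_pow, hk, ← map_pow, hα3, map_natCast, map_pow, ← hαdef, hα3]
    have := eq_of_pow_three_eq hK hθ0 hk3
    rw [this] at hk
    exact hθσ hk.symm
  · have := hg (τ z)
    rw [h3, hττ, AlgEquiv.mul_apply] at this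
    exact this.symm

omit [NumberField K] in
/-- `τσ² = στ` (from `τσ = σ²τ` and `σ³ = 1`). [folklore] -/
theorem apply_apply_apply_eq (F : IntermediateField ℚ L) [IsGalois F L]
    {σ : L ≃ₐ[F] L} (hσ : ∀ g : L ≃ₐ[F] L, g ∈ Subgroup.zpowers σ)
    (hFL : Module.finrank F L = 3) {τ : L ≃ₐ[K] L}
    (hτσ : ∀ z : L, τ (σ z) = σ (σ (τ z))) (z : L) : τ (σ (σ z)) = σ (τ z) := by
  have hσ3 := pow_three_eq_one_of_finrank_eq_three hσ hFL
  have hσσσ : ∀ w, σ (σ (σ w)) = w := fun w => by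
    rw [← AlgEquiv.mul_apply, ← AlgEquiv.mul_apply, ← pow_three', hσ3, AlgEquiv.one_apply]
  rw [hτσ, hτσ, hσσσ]

end Summit.QuantumAdvantage.QuantumAdvantage.Theorems.LinnikCubicClassGroups
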